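import Summits.QuantumFields.BalabanUV.T4Continuum.Support.NE3FramePotBoundSharp
import HarnessLib

/-!
# T⁴ programme, node NE3, route (H♮) row C1 (file 4♯) — THE ONE-LEVEL COMB DEFECT IN ℓ²(TORUS) WITHOUT THE BOX:
# `l2sq (periodBox N′) (Dstr L W Y) ≤ (16(d+1)(d+4)L²a)²·C2S d L·l2sq (periodBox (L·N′)) Y`,  `C2S d L = 100 080 016·d²·L`

NE3 formalisation swarm `b2b-balaban-t4-ne3-formalise-*`, LEAF PROVER 04 (gen 6), the author lineage of C1 (`NE3CovariantLineSums*`, gen 4).  The located fact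
(this seat's INTENT «C1-L2♯»): the class hypothesis `S2sum d L (k+1) x ≤ ρ∕2` displayed by H4-W ∕ H4-W♯ ∕ K6b-3 ∕ K6c-1a is NOT implied by the tower class
`LevelSmall` with C1 file 4's crude constant `C2sq d L = d²·Csup²·(2·nbRad+1)^{2d}` (`√C2sq ≈ 3.1·10¹¹` at d = 4, L = 2), which came — exactly as in H4 —
from bounding every letter of the local words by the ℓ¹ norm of an l¹-box (`lnorm_le_region`, radius `nbRad`) and counting box multiplicities.
THE BOX IS NOT NEEDED: every word of the local weight `locL1 L Y q κ` of C1 file 1 — the loops `Γ_{q,x} ∪ [x, x+Le_κ] ∪ Γ_{q+Le_κ,x+Le_κ}⁻¹ ∪ [q+Le_κ, q]`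
of (42), the segment `[q, q+Le_κ]`, the translated trees from `q + Le_κ` — lives in the TWO blocks `B(q)` and `B(q+Le_κ)` as sub-segments of their
lines (the middle segment `[x, x+Le_κ]` is a sub-segment of the DOUBLE κ-line, split at the block face).  Per-segment Cauchy–Schwarz as in H4♯
(`NE3FramePotBoundSharp.lnorm_treeWord_boxVec_sq_le` BY NAME, plus the reversal invariance of `lnorm` and a general sub-segment lemma) gives

  `locL1 L Y q κ ≤ 5002·√(dL·E(B_q)) + 2508·√(dL·E(B_{q+Le_κ}))`,   `E(B_q) := Σ_{v∈periodBox L} Σ_κ′ ‖Y (q+v) κ′‖²`,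

hence `‖Dstr L W Y (y,κ)‖² ≤ w²·2·5002²·dL·(E(B_{L•y}) + E(B_{L•(y+e_κ)}))` and, by the exact block tiling of the torus plus one periodic shift per direction,
the ℓ² bound with **`C2S d L = 2·(2·5002²)·d²·L = 100 080 016·d²·L`** (≈ 3.2·10⁹ at d = 4, L = 2; `√C2S ≈ 5.7·10⁴`) in place of `C2sq ≈ 9.7·10²²`.  File 5♯
(`NE3CovariantLineSumsL2TowerSharp`) runs the ℓ² tower with `delta2S := w·√C2S` and shows that the level sum `S2sumS ≤ ρ∕2` IS a theorem of the class.

CONTENT (all [folklore]; 0 sorry; 0 def — the constant `C2S = 100 080 016·d²·L` is written out):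
§1 `lnorm_revWord` (a word read backwards weighs the same), `sum_range_norm_le_sqrt_line'` (a sub-segment `q + u + [0,t)·e_κ` with `u_κ + t ≤ L` against
   `√(L·E_κ(B_q))`), `lnorm_seg_double_le` (the middle segment against the two blocks), `lnorm_loopWord_le`, **`locL1_le_sharp`**, `locL1_sq_le_sharp`;
§2 **`l2sq_Dstr_le_sharp`** — C1 file 4's `l2sq_Dstr_le` with `C2sq d L` replaced by `100 080 016·d²·L` (same binders).

HONEST FRAMING.  Lattice kinematics on OUR frame: a displayed constant shrinks; nothing about Bałaban's minimisers; (P♮)_W, (ML_w) at W ≠ 1, T-E_w and NE3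
are NOT proved; spine PROVED 0∕9; finite T⁴ rung (B)+1 — NOT infinite volume, NOT mass gap, NOT BetaPertH, NOT Clay.  ABSOLUTE RULE kept (no printed sentence
is a hypothesis; context only: [Balaban1985Averaging] (42) p. 23, (120)–(125) pp. 35–36).  PLACEMENT: `Summits/QuantumFields/BalabanUV/`.
HONEST DEPENDENCY: continuum YM on T⁴ ⇐ BetaPertH ∧ nine spine estimates (0/9 proved); BetaPertH ⇐ (D1) ∧ (D4) ∧ CAP+tail; G-an2-4 gates asym, D1 and NE2/3/4.
-/

set_option autoImplicit false

open scoped BigOperators Matrix.Norms.L2Operator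
open Finset

namespace Summit.QuantumFields.BalabanUV.T4Continuum.NE3CovariantLineSumsL2Sharp

open Literature.MathematicalPhysics.QuantumFieldTheory.Balaban1983to89
open B7Prop1Explicit B7Prop2Explicit
open T4AveragingDeficitWall (IsUnitaryCfg SmallField)
open T4AveragingDeficitWallBoundary (periodBox IsPeriodicCfg mem_periodBox sum_periodBox_shift)
open AveragingDeficitPeriodicCounting (IsPeriodicDir)
open AveragingDeficitTransport (lnorm lnorm_cons)
open AveragingDeficitNearIdentity (lnorm_nonneg)
open AveragingDeficitSideDeriv (loopWord)
open BlockAveragePushDirSplit (sum_blockWeight_eq_one)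
open BlockAverageDbarLinBound (loopL1 treeL1')
open BlockAverageDbarLinNorms (lnorm_seg_eq_sum)
open NE3BlockPoincareCore (sum_blocks_torus)
open NE3CovariantLineSums (locL1 norm_Qbar_sub_Qstr_le)
open NE3CovariantLineSumsTower (Dstr)
open NE3CovariantLineSumsL2 (l2sq l2sq_nonneg)
open NE3FramePotBoundSharp (lnorm_append lnorm_treeWord_boxVec_sq_le)

noncomputable section

variable {d : ℕ} {n : Type*} [Fintype n] [DecidableEq n]

/-! ## §1 The local words live in two blocks -/

/-- **A WORD READ BACKWARDS WEIGHS THE SAME**: `lnorm ψ (x + disp w) (revWord w) = lnorm ψ x w` (the same bonds are visited). [folklore] -/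
theorem lnorm_revWord (ψ : Site d → Fin d → Matrix n n ℂ) :
    ∀ (x : Site d) (w : List (Letter d)), lnorm ψ (x + disp w) (revWord w) = lnorm ψ x w
  | x, [] => by simp
  | x, l :: w => by
      rw [revWord_cons, disp_cons, ← add_assoc, lnorm_append, lnorm_revWord ψ (x + l.vec) w, disp_revWord, add_neg_cancel_right,
        lnorm_cons, lnorm_cons, AveragingDeficitTransport.lnorm_nil, add_zero, add_comm]
      obtain ⟨μ, b⟩ := l
      cases b <;> simp [Letter.rev]

/-- **A SUB-SEGMENT OF ONE LINE OF THE BLOCK AGAINST THE BLOCK'S LINE ENERGY** (general start): for an offset `u` with `u_j ∈ [0,L)` (`j ≠ κ`),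
`0 ≤ u_κ` and `u_κ + t ≤ L`: `Σ_{i<t} ‖Y (q + u + i•e_κ) κ‖ ≤ √(L·Σ_{v∈periodBox L} ‖Y (q+v) κ‖²)`. [folklore] -/
theorem sum_range_norm_le_sqrt_line' {L : ℕ} (Y : Site d → Fin d → Matrix n n ℂ) (q u : Site d) (κ : Fin d)
    (hu : ∀ j, j ≠ κ → 0 ≤ u j ∧ u j < L) (huκ : 0 ≤ u κ) {t : ℕ} (ht : u κ + t ≤ L) :
    ∑ i ∈ range t, ‖Y (q + u + (i : ℤ) • e κ) κ‖
      ≤ Real.sqrt ((L : ℝ) * ∑ v ∈ periodBox (d := d) L, ‖Y (q + v) κ‖ ^ 2) := by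
  set f : ℕ → ℝ := fun i => ‖Y (q + u + (i : ℤ) • e κ) κ‖ with hf
  have hf0 : ∀ i, 0 ≤ f i := fun i => norm_nonneg _
  have htL : t ≤ L := by
    have : (t : ℤ) ≤ L := by linarith
    exact_mod_cast this
  -- (a) Cauchy–Schwarz on the `t ≤ L` terms
  have h2 : (∑ i ∈ range t, f i) ^ 2 ≤ (L : ℝ) * ∑ i ∈ range t, f i ^ 2 := by
    have h := sq_sum_le_card_mul_sum_sq (s := range t) (f := f)
    rw [Finset.card_range] at h
    exact h.trans (mul_le_mul_of_nonneg_right (by exact_mod_cast htL) (Finset.sum_nonneg fun i _ => sq_nonneg _))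
  -- (b) the segment's sites are distinct sites of the block
  set φ : ℕ → Site d := fun i => u + (i : ℤ) • e κ with hφ
  have hφκ : ∀ i : ℕ, φ i κ = u κ + (i : ℤ) := fun i => by
    simp only [hφ, Pi.add_apply, Pi.smul_apply, e_apply, if_true, smul_eq_mul, mul_one]
  have hφj : ∀ (i : ℕ) (j : Fin d), j ≠ κ → φ i j = u j := fun i j hj => by
    simp only [hφ, Pi.add_apply, Pi.smul_apply, e_apply, if_neg hj, smul_eq_mul, mul_zero, add_zero]
  have hinj : Set.InjOn φ ↑(range t) := by
    intro i _ i' _ h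
    have hκ' := congr_fun h κ
    rw [hφκ, hφκ] at hκ'
    exact_mod_cast (add_left_cancel hκ')
  have himg : (range t).image φ ⊆ periodBox (d := d) L := by
    intro v hv
    obtain ⟨i, hi, rfl⟩ := Finset.mem_image.mp hv
    have hit : i < t := Finset.mem_range.mp hi
    rw [mem_periodBox]
    intro j
    by_cases hj : j = κ
    · subst hj
      rw [hφκ]
      refine ⟨by positivity, ?_⟩
      have : (i : ℤ) < t := by exact_mod_cast hit
      linarith
    · rw [hφj i j hj]; exact hu j hj
  have h3 : ∑ i ∈ range t, f i ^ 2 ≤ ∑ v ∈ periodBox (d := d) L, ‖Y (q + v) κ‖ ^ 2 := by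
    have e1 : ∑ i ∈ range t, f i ^ 2 = ∑ v ∈ (range t).image φ, ‖Y (q + v) κ‖ ^ 2 := by
      rw [Finset.sum_image hinj]
      refine Finset.sum_congr rfl fun i _ => ?_
      simp only [hf, hφ, add_assoc]
    rw [e1]
    exact Finset.sum_le_sum_of_subset_of_nonneg himg fun v _ _ => sq_nonneg _
  have h4 : (∑ i ∈ range t, f i) ^ 2 ≤ (L : ℝ) * ∑ v ∈ periodBox (d := d) L, ‖Y (q + v) κ‖ ^ 2 :=
    h2.trans (mul_le_mul_of_nonneg_left h3 (Nat.cast_nonneg L))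
  exact (le_abs_self _).trans (Real.abs_le_sqrt h4)

/-- One line energy is at most the block energy, with the `d·L` weight: `L·E_κ(B_q) ≤ (d·L)·E(B_q)`. [folklore] -/
theorem line_le_block {L : ℕ} (Y : Site d → Fin d → Matrix n n ℂ) (q : Site d) (κ : Fin d) :
    (L : ℝ) * ∑ v ∈ periodBox (d := d) L, ‖Y (q + v) κ‖ ^ 2 ≤ ((d : ℝ) * L) * ∑ v ∈ periodBox (d := d) L, ∑ μ : Fin d, ‖Y (q + v) μ‖ ^ 2 := by
  have h1 : ∑ v ∈ periodBox (d := d) L, ‖Y (q + v) κ‖ ^ 2 ≤ ∑ v ∈ periodBox (d := d) L, ∑ μ : Fin d, ‖Y (q + v) μ‖ ^ 2 :=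
    Finset.sum_le_sum fun v _ => Finset.single_le_sum (f := fun μ => ‖Y (q + v) μ‖ ^ 2) (fun μ _ => sq_nonneg _) (Finset.mem_univ κ)
  have hd1 : (L : ℝ) ≤ (d : ℝ) * L := by
    have hd : 1 ≤ d := Nat.one_le_iff_ne_zero.mpr (fun h => by subst h; exact Fin.elim0 κ)
    have : (1 : ℝ) ≤ d := by exact_mod_cast hd
    nlinarith [Nat.cast_nonneg (α := ℝ) L]
  have hE0 : 0 ≤ ∑ v ∈ periodBox (d := d) L, ‖Y (q + v) κ‖ ^ 2 := Finset.sum_nonneg fun v _ => sq_nonneg _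
  calc (L : ℝ) * ∑ v ∈ periodBox (d := d) L, ‖Y (q + v) κ‖ ^ 2 ≤ ((d : ℝ) * L) * ∑ v ∈ periodBox (d := d) L, ‖Y (q + v) κ‖ ^ 2 :=
        mul_le_mul_of_nonneg_right hd1 hE0
    _ ≤ ((d : ℝ) * L) * ∑ v ∈ periodBox (d := d) L, ∑ μ : Fin d, ‖Y (q + v) μ‖ ^ 2 := mul_le_mul_of_nonneg_left h1 (by positivity)

/-- The straight segment `[q, q + Le_κ]` against its block: `lnorm Y q (seg κ L) ≤ √((d·L)·E(B_q))`. [folklore] -/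
theorem lnorm_seg_le_block {L : ℕ} (hL : 1 ≤ L) (Y : Site d → Fin d → Matrix n n ℂ) (q : Site d) (κ : Fin d) :
    lnorm Y q (seg κ (L : ℤ)) ≤ Real.sqrt (((d : ℝ) * L) * ∑ v ∈ periodBox (d := d) L, ∑ μ : Fin d, ‖Y (q + v) μ‖ ^ 2) := by
  rw [lnorm_seg_eq_sum]
  have hL' : (0 : ℤ) < L := by exact_mod_cast hL
  have h := NE3FramePotBoundSharp.sum_range_norm_le_sqrt_line Y q 0 κ (fun j => ⟨le_rfl, hL'⟩) rfl (t := L) le_rfl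
  simp only [add_zero] at h
  exact h.trans (Real.sqrt_le_sqrt (line_le_block Y q κ))

/-- **THE MIDDLE SEGMENT `[x, x+Le_κ]` OF A LOOP AGAINST THE TWO BLOCKS**: for `x = q + boxVec L r`,
`lnorm Y x (seg κ L) ≤ √((d·L)·E(B_q)) + √((d·L)·E(B_{q+Le_κ}))` (split at the block face: `L − r_κ` bonds in `B(q)`, `r_κ` bonds in `B(q+Le_κ)`). [folklore] -/
theorem lnorm_seg_double_le {L : ℕ} (Y : Site d → Fin d → Matrix n n ℂ) (q : Site d) (κ : Fin d) (r : Fin d → Fin L) :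
    lnorm Y (q + boxVec L r) (seg κ (L : ℤ))
      ≤ Real.sqrt (((d : ℝ) * L) * ∑ v ∈ periodBox (d := d) L, ∑ μ : Fin d, ‖Y (q + v) μ‖ ^ 2)
        + Real.sqrt (((d : ℝ) * L) * ∑ v ∈ periodBox (d := d) L, ∑ μ : Fin d, ‖Y (q + (L : ℤ) • e κ + v) μ‖ ^ 2) := by
  set t₀ : ℕ := L - (r κ : ℕ) with ht₀
  have hrL : (r κ : ℕ) < L := (r κ).2
  have hsum : t₀ + (r κ : ℕ) = L := by omega
  -- split the word at the block face
  have hsplit : seg κ (L : ℤ) = seg κ (t₀ : ℤ) ++ seg κ ((r κ : ℕ) : ℤ) := by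
    rw [seg_natCast, seg_natCast, seg_natCast, List.replicate_append_replicate, hsum]
  rw [hsplit, lnorm_append, disp_seg, lnorm_seg_eq_sum, lnorm_seg_eq_sum]
  have hbv : ∀ j, 0 ≤ boxVec L r j ∧ boxVec L r j < L := fun j => ⟨by simp [boxVec], by simp [boxVec]⟩
  -- first part: inside `B(q)`, offset `boxVec L r`, `r_κ + t₀ = L`
  have h1 := sum_range_norm_le_sqrt_line' Y q (boxVec L r) κ (fun j _ => hbv j) (hbv κ).1 (t := t₀)
    (by simp only [boxVec]; omega)
  -- second part: inside `B(q + Le_κ)`, offset `boxVec L r − r_κ e_κ` (κ-coordinate 0), `r_κ` bonds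
  set u' : Site d := boxVec L r - ((r κ : ℕ) : ℤ) • e κ with hu'
  have hu'κ : u' κ = 0 := by simp [hu', boxVec, e_apply]
  have hu'j : ∀ j, j ≠ κ → 0 ≤ u' j ∧ u' j < L := fun j hj => by
    simp only [hu', Pi.sub_apply, Pi.smul_apply, e_apply, if_neg hj, smul_eq_mul, mul_zero, sub_zero]; exact hbv j
  have hbase : q + boxVec L r + (t₀ : ℤ) • e κ = q + (L : ℤ) • e κ + u' := by
    have ht₀' : ((t₀ : ℕ) : ℤ) = (L : ℤ) - ((r κ : ℕ) : ℤ) := by rw [ht₀]; push_cast [Nat.cast_sub hrL.le]; ring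
    rw [hu', ht₀', sub_smul]
    abel
  have h2 := sum_range_norm_le_sqrt_line' Y (q + (L : ℤ) • e κ) u' κ hu'j (le_of_eq hu'κ.symm) (t := (r κ : ℕ))
    (by rw [hu'κ, zero_add]; exact_mod_cast hrL.le)
  have h2' : ∑ i ∈ range (r κ : ℕ), ‖Y (q + boxVec L r + (t₀ : ℤ) • e κ + (i : ℤ) • e κ) κ‖
      ≤ Real.sqrt ((L : ℝ) * ∑ v ∈ periodBox (d := d) L, ‖Y (q + (L : ℤ) • e κ + v) κ‖ ^ 2) := by
    rw [hbase]; exact h2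
  refine add_le_add (h1.trans (Real.sqrt_le_sqrt (line_le_block Y q κ))) ?_
  exact h2'.trans (Real.sqrt_le_sqrt (line_le_block Y (q + (L : ℤ) • e κ) κ))

/-- **ONE LOOP OF (42) AGAINST THE TWO BLOCKS**: for `x = q + boxVec L r`, the loop word `Γ_{q,x} ∪ [x, x+Le_κ] ∪ Γ⁻¹ ∪ [q+Le_κ, q]` satisfies
`lnorm Y q (loopWord L κ (boxVec L r)) ≤ 3·√((d·L)·E(B_q)) + 2·√((d·L)·E(B_{q+Le_κ}))`, a bound independent of `r`. [folklore] -/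
theorem lnorm_loopWord_le {L : ℕ} (hL : 1 ≤ L) (Y : Site d → Fin d → Matrix n n ℂ) (q : Site d) (κ : Fin d) (r : Fin d → Fin L) :
    lnorm Y q (loopWord L κ (boxVec L r))
      ≤ 3 * Real.sqrt (((d : ℝ) * L) * ∑ v ∈ periodBox (d := d) L, ∑ μ : Fin d, ‖Y (q + v) μ‖ ^ 2)
        + 2 * Real.sqrt (((d : ℝ) * L) * ∑ v ∈ periodBox (d := d) L, ∑ μ : Fin d, ‖Y (q + (L : ℤ) • e κ + v) μ‖ ^ 2) := by
  set A : ℝ := Real.sqrt (((d : ℝ) * L) * ∑ v ∈ periodBox (d := d) L, ∑ μ : Fin d, ‖Y (q + v) μ‖ ^ 2) with hA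
  set B : ℝ := Real.sqrt (((d : ℝ) * L) * ∑ v ∈ periodBox (d := d) L, ∑ μ : Fin d, ‖Y (q + (L : ℤ) • e κ + v) μ‖ ^ 2) with hB
  -- the four pieces of the loop word
  have hw : loopWord L κ (boxVec L r)
      = treeWord (boxVec L r) ++ (seg κ (L : ℤ) ++ (revWord (treeWord (boxVec L r)) ++ seg κ (-(L : ℤ)))) := by
    simp [loopWord, gammaWord, List.append_assoc]
  rw [hw, lnorm_append, lnorm_append, lnorm_append, disp_treeWord, disp_seg, disp_revWord, disp_treeWord]
  -- (1) the tree from `q`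
  have h1 : lnorm Y q (treeWord (boxVec L r)) ≤ A :=
    (le_abs_self _).trans (Real.abs_le_sqrt (lnorm_treeWord_boxVec_sq_le hL Y q r))
  -- (2) the middle segment
  have h2 : lnorm Y (q + boxVec L r) (seg κ (L : ℤ)) ≤ A + B := lnorm_seg_double_le Y q κ r
  -- (3) the reversed tree from `q + boxVec r + Le_κ` = the tree from `q + Le_κ`
  have h3 : lnorm Y (q + boxVec L r + (L : ℤ) • e κ) (revWord (treeWord (boxVec L r))) ≤ B := by
    have e1 : q + boxVec L r + (L : ℤ) • e κ = q + (L : ℤ) • e κ + disp (treeWord (boxVec L r)) := by rw [disp_treeWord]; abel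
    rw [e1, lnorm_revWord]
    exact (le_abs_self _).trans (Real.abs_le_sqrt (lnorm_treeWord_boxVec_sq_le hL Y (q + (L : ℤ) • e κ) r))
  -- (4) the backward segment from `q + Le_κ` = the forward segment from `q`
  have h4 : lnorm Y (q + boxVec L r + (L : ℤ) • e κ + -boxVec L r) (seg κ (-(L : ℤ))) ≤ A := by
    have e1 : q + boxVec L r + (L : ℤ) • e κ + -boxVec L r = q + disp (seg κ (L : ℤ)) := by rw [disp_seg]; abel
    rw [e1, ← revWord_seg, lnorm_revWord]
    exact lnorm_seg_le_block hL Y q κ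
  linarith

/-- **THE LOCAL WEIGHT OF C1 AGAINST THE TWO BLOCKS**: `locL1 L Y q κ ≤ 5002·√((d·L)·E(B_q)) + 2508·√((d·L)·E(B_{q+Le_κ}))`. [folklore] -/
theorem locL1_le_sharp {L : ℕ} (hL : 1 ≤ L) (Y : Site d → Fin d → Matrix n n ℂ) (q : Site d) (κ : Fin d) :
    locL1 L Y q κ
      ≤ 5002 * Real.sqrt (((d : ℝ) * L) * ∑ v ∈ periodBox (d := d) L, ∑ μ : Fin d, ‖Y (q + v) μ‖ ^ 2)
        + 2508 * Real.sqrt (((d : ℝ) * L) * ∑ v ∈ periodBox (d := d) L, ∑ μ : Fin d, ‖Y (q + (L : ℤ) • e κ + v) μ‖ ^ 2) := by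
  set A : ℝ := Real.sqrt (((d : ℝ) * L) * ∑ v ∈ periodBox (d := d) L, ∑ μ : Fin d, ‖Y (q + v) μ‖ ^ 2) with hA
  set B : ℝ := Real.sqrt (((d : ℝ) * L) * ∑ v ∈ periodBox (d := d) L, ∑ μ : Fin d, ‖Y (q + (L : ℤ) • e κ + v) μ‖ ^ 2) with hB
  have hwt := sum_blockWeight_eq_one (d := d) L hL
  have hloop : loopL1 L Y q κ ≤ 3 * A + 2 * B := by
    unfold loopL1
    calc ∑ r : Fin d → Fin L, ((L : ℝ) ^ d)⁻¹ * lnorm Y q (loopWord L κ (boxVec L r))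
        ≤ ∑ _r : Fin d → Fin L, ((L : ℝ) ^ d)⁻¹ * (3 * A + 2 * B) :=
          Finset.sum_le_sum fun r _ => mul_le_mul_of_nonneg_left (lnorm_loopWord_le hL Y q κ r) (by positivity)
      _ = 3 * A + 2 * B := by rw [← Finset.sum_mul, hwt, one_mul]
  have htree : treeL1' L Y q κ ≤ B := by
    unfold treeL1'
    calc ∑ r : Fin d → Fin L, ((L : ℝ) ^ d)⁻¹ * lnorm Y (q + (L : ℤ) • e κ) (treeWord (boxVec L r))
        ≤ ∑ _r : Fin d → Fin L, ((L : ℝ) ^ d)⁻¹ * B :=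
          Finset.sum_le_sum fun r _ => mul_le_mul_of_nonneg_left
            ((le_abs_self _).trans (Real.abs_le_sqrt (lnorm_treeWord_boxVec_sq_le hL Y (q + (L : ℤ) • e κ) r))) (by positivity)
      _ = B := by rw [← Finset.sum_mul, hwt, one_mul]
  have hseg : lnorm Y q (seg κ (L : ℤ)) ≤ A := lnorm_seg_le_block hL Y q κ
  unfold locL1
  linarith

/-- `0 ≤ locL1`. [folklore] -/
theorem locL1_nonneg (L : ℕ) (Y : Site d → Fin d → Matrix n n ℂ) (q : Site d) (κ : Fin d) : 0 ≤ locL1 L Y q κ := by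
  unfold locL1 loopL1 treeL1'
  have h1 : 0 ≤ lnorm Y q (seg κ (L : ℤ)) := lnorm_nonneg _ _ _
  have h2 : 0 ≤ ∑ r : Fin d → Fin L, ((L : ℝ) ^ d)⁻¹ * lnorm Y q (loopWord L κ (boxVec L r)) :=
    Finset.sum_nonneg fun r _ => mul_nonneg (by positivity) (lnorm_nonneg _ _ _)
  have h3 : 0 ≤ ∑ r : Fin d → Fin L, ((L : ℝ) ^ d)⁻¹ * lnorm Y (q + (L : ℤ) • e κ) (treeWord (boxVec L r)) :=
    Finset.sum_nonneg fun r _ => mul_nonneg (by positivity) (lnorm_nonneg _ _ _)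
  positivity

/-- … squared: `locL1² ≤ 2·5002²·(d·L)·(E(B_q) + E(B_{q+Le_κ}))`. [folklore] -/
theorem locL1_sq_le_sharp {L : ℕ} (hL : 1 ≤ L) (Y : Site d → Fin d → Matrix n n ℂ) (q : Site d) (κ : Fin d) :
    locL1 L Y q κ ^ 2
      ≤ 50040008 * (((d : ℝ) * L) * (∑ v ∈ periodBox (d := d) L, ∑ μ : Fin d, ‖Y (q + v) μ‖ ^ 2
          + ∑ v ∈ periodBox (d := d) L, ∑ μ : Fin d, ‖Y (q + (L : ℤ) • e κ + v) μ‖ ^ 2)) := by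
  have hdL : 0 ≤ (d : ℝ) * L := by positivity
  have hE₁0 : 0 ≤ ((d : ℝ) * L) * ∑ v ∈ periodBox (d := d) L, ∑ μ : Fin d, ‖Y (q + v) μ‖ ^ 2 :=
    mul_nonneg hdL (Finset.sum_nonneg fun v _ => Finset.sum_nonneg fun μ _ => sq_nonneg _)
  have hE₂0 : 0 ≤ ((d : ℝ) * L) * ∑ v ∈ periodBox (d := d) L, ∑ μ : Fin d, ‖Y (q + (L : ℤ) • e κ + v) μ‖ ^ 2 :=
    mul_nonneg hdL (Finset.sum_nonneg fun v _ => Finset.sum_nonneg fun μ _ => sq_nonneg _)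
  have key : ∀ (x a b : ℝ), 0 ≤ x → x ≤ 5002 * a + 2508 * b → x ^ 2 ≤ 50040008 * (a ^ 2 + b ^ 2) := by
    intro x a b hx hxle
    have h : x ^ 2 ≤ (5002 * a + 2508 * b) ^ 2 := pow_le_pow_left₀ hx hxle 2
    nlinarith [sq_nonneg (5002 * a - 2508 * b), sq_nonneg a, sq_nonneg b]
  have h2 := key _ _ _ (locL1_nonneg L Y q κ) (locL1_le_sharp hL Y q κ)
  rw [Real.sq_sqrt hE₁0, Real.sq_sqrt hE₂0] at h2
  calc locL1 L Y q κ ^ 2 ≤ _ := h2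
    _ = _ := by ring

/-! ## §2 The one-level defect in ℓ²(torus), sharp -/

/-- **THE ONE-LEVEL DEFECT IN ℓ²(TORUS), SHARP**: for unitary small-field `W` (`512(d+1)(d+4)L²a ≤ 1`, `SmallField W a`) and an `(L·N′)`-periodic `Y`,
`l2sq (periodBox N′) (Dstr L W Y) ≤ (16(d+1)(d+4)L²a)²·(100 080 016·d²·L)·l2sq (periodBox (L·N′)) Y` — C1 file 4's `l2sq_Dstr_le` with the box constant
`C2sq d L = d²·Csup²·(2·nbRad+1)^{2d}` replaced by the explicit `C2S := 100 080 016·d²·L` (written out; no definition). [folklore] -/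
theorem l2sq_Dstr_le_sharp [Nonempty n] {L : ℕ} (hL : 1 ≤ L) {N' : ℕ} (hN' : 1 ≤ N') {W : Site d → Fin d → (Matrix n n ℂ)ˣ}
    (hWu : IsUnitaryCfg W) {a : ℝ} (ha : 0 ≤ a) (hsmall : 512 * (d + 1) * (d + 4) * (L : ℝ) ^ 2 * a ≤ 1) (hWa : SmallField W a)
    {Y : Site d → Fin d → Matrix n n ℂ} (hY : IsPeriodicDir Y ((L * N' : ℕ) : ℤ)) :
    l2sq (periodBox (d := d) N') (Dstr L W Y)
      ≤ (16 * (d + 1) * (d + 4) * (L : ℝ) ^ 2 * a) ^ 2 * (100080016 * (d : ℝ) ^ 2 * L) * l2sq (periodBox (d := d) (L * N')) Y := by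
  set w : ℝ := 16 * (d + 1) * (d + 4) * (L : ℝ) ^ 2 * a with hw
  have hw0 : 0 ≤ w := by rw [hw]; positivity
  -- block energies
  set g : Site d → ℝ := fun x => ∑ μ : Fin d, ‖Y x μ‖ ^ 2 with hg
  set G : Site d → ℝ := fun q => ∑ v ∈ periodBox (d := d) L, g (q + v) with hG
  have hg0 : ∀ x, 0 ≤ g x := fun x => by rw [hg]; positivity
  -- pointwise: `‖Dstr (y,κ)‖² ≤ w²·K·dL·(G(L•y) + G(L•y + Le_κ))`
  have hpt : ∀ (y : Site d) (κ : Fin d), ‖Dstr L W Y y κ‖ ^ 2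
      ≤ w ^ 2 * (50040008 * (((d : ℝ) * L) * (G ((L : ℤ) • y) + G ((L : ℤ) • y + (L : ℤ) • e κ)))) := by
    intro y κ
    have h1 : ‖Dstr L W Y y κ‖ ≤ w * locL1 L Y ((L : ℤ) • y) κ := by
      unfold Dstr; exact norm_Qbar_sub_Qstr_le hL hWu ha hsmall hWa Y y κ
    have h2 := locL1_sq_le_sharp (d := d) hL Y ((L : ℤ) • y) κ
    have h0 : 0 ≤ ‖Dstr L W Y y κ‖ := norm_nonneg _
    calc ‖Dstr L W Y y κ‖ ^ 2 ≤ (w * locL1 L Y ((L : ℤ) • y) κ) ^ 2 := pow_le_pow_left₀ h0 h1 2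
      _ = w ^ 2 * locL1 L Y ((L : ℤ) • y) κ ^ 2 := by ring
      _ ≤ w ^ 2 * (50040008 * (((d : ℝ) * L) * (G ((L : ℤ) • y) + G ((L : ℤ) • y + (L : ℤ) • e κ)))) := by
          refine mul_le_mul_of_nonneg_left ?_ (by positivity)
          simpa only [hG, hg] using h2
  -- the torus sums of the block energies: exact tiling, and one periodic shift per direction
  have htile : ∑ y ∈ periodBox (d := d) N', G ((L : ℤ) • y) = l2sq (periodBox (d := d) (L * N')) Y := by
    simp only [hG]
    rw [sum_blocks_torus hL N' g]
    rfl
  have hGper : ∀ (y : Site d) (τ : Fin d), G ((L : ℤ) • (y + (N' : ℤ) • e τ)) = G ((L : ℤ) • y) := by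
    intro y τ
    simp only [hG, hg]
    refine Finset.sum_congr rfl fun v _ => Finset.sum_congr rfl fun μ _ => ?_
    have e1 : (L : ℤ) • (y + (N' : ℤ) • e τ) + v = ((L : ℤ) • y + v) + ((L * N' : ℕ) : ℤ) • e τ := by
      rw [smul_add, smul_smul]; push_cast; abel
    rw [e1, hY]
  have hshift : ∀ κ : Fin d, ∑ y ∈ periodBox (d := d) N', G ((L : ℤ) • y + (L : ℤ) • e κ) = l2sq (periodBox (d := d) (L * N')) Y := by
    intro κ
    have h := sum_periodBox_shift N' hN' (g := fun y => G ((L : ℤ) • y)) (fun y τ => hGper y τ) (e κ)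
    have e2 : ∀ y : Site d, G ((L : ℤ) • y + (L : ℤ) • e κ) = G ((L : ℤ) • (y + e κ)) := fun y => by rw [smul_add]
    simp only [e2]
    rw [h]
    exact htile
  -- assemble
  unfold l2sq
  calc ∑ y ∈ periodBox (d := d) N', ∑ κ : Fin d, ‖Dstr L W Y y κ‖ ^ 2
      ≤ ∑ y ∈ periodBox (d := d) N', ∑ κ : Fin d,
          w ^ 2 * (50040008 * (((d : ℝ) * L) * (G ((L : ℤ) • y) + G ((L : ℤ) • y + (L : ℤ) • e κ)))) :=
        Finset.sum_le_sum fun y _ => Finset.sum_le_sum fun κ _ => hpt y κ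
    _ = w ^ 2 * (50040008 * ((d : ℝ) * L)) *
          (∑ κ : Fin d, ∑ y ∈ periodBox (d := d) N', G ((L : ℤ) • y)
            + ∑ κ : Fin d, ∑ y ∈ periodBox (d := d) N', G ((L : ℤ) • y + (L : ℤ) • e κ)) := by
        rw [Finset.sum_comm, ← Finset.sum_add_distrib, Finset.mul_sum]
        refine Finset.sum_congr rfl fun κ _ => ?_
        rw [← Finset.sum_add_distrib, Finset.mul_sum]
        exact Finset.sum_congr rfl fun y _ => by ring
    _ = w ^ 2 * (50040008 * ((d : ℝ) * L)) * ((d : ℝ) * l2sq (periodBox (d := d) (L * N')) Y + (d : ℝ) * l2sq (periodBox (d := d) (L * N')) Y) := by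
        rw [Finset.sum_congr rfl fun κ _ => hshift κ, htile, Finset.sum_const, Finset.card_univ, Fintype.card_fin, nsmul_eq_mul]
    _ = w ^ 2 * (100080016 * (d : ℝ) ^ 2 * L) * ∑ x ∈ periodBox (d := d) (L * N'), ∑ κ : Fin d, ‖Y x κ‖ ^ 2 := by
        unfold l2sq; ring

end

end Summit.QuantumFields.BalabanUV.T4Continuum.NE3CovariantLineSumsL2Sharp
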